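import Literature.Probability.LatticeModels.SahiThirdOrderCorrelation
import Literature.Probability.LatticeModels.ProdBernoulliIndependence
import Mathlib.Tactic.Linarith
import HarnessLib

/-!
# Sahi's `C₃` is true to first order at the degenerate face "one coordinate near-surely in `A`"
# (Sahi programme, prover prim-sahi-p2 gen 38)

Support file of the cell `prim-sahi` (`--supports stmt-CriticalPhenomena-4575`).  No definitions, no named
facts, no sorries; standard axioms.  Memo `run/shared/lean/prim/prim-sahi/FROM-prim-sahi-p2-gen38-PK-WDOM-REFUTED.md`
§2(2e).

Setting.  Sahi's third-order functional of three events is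
`E₃(A,B,C) = 2P(ABC) + P(A)P(B)P(C) − P(A)P(BC) − P(B)P(AC) − P(C)P(AB)` (`sahiE3`); Sahi's conjecture
`C₃` (2008, Conj. 5 at `n = 3`; Kahn) asserts `E₃ ≥ 0` for increasing events under a product measure.  Put one
more independent coordinate `x₀` of probability `1 − ε` in front of a product space and let `A ⊇ {x₀ = 1}`
(section `A¹ = Ω`), with sections `A⁰`, `B⁰ ⊆ B¹`, `C⁰ ⊆ C¹` (all increasing) and `B¹, C¹` independent.
Then `E₃(A,B,C) = 0` at `ε = 0` and, since every probability is affine in `ε`,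

  `E₃(A,B,C) = ε · Ψ + O(ε²)`,  `Ψ = 2P(A⁰B⁰C⁰) − P(B⁰C⁰) − P(B¹)P(A⁰C⁰) − P(C¹)P(A⁰B⁰) + P(B¹)P(C¹)`

(memo §2(2e); the computation is elementary bookkeeping and is not formalised here).  A negative `Ψ` for
some choice of sections would therefore refute `C₃`.  THIS FILE PROVES `Ψ ≥ 0` for all such sections
(`SahiFace.face_firstOrder_nonneg`), indeed the sharper
`Ψ ≥ P(B¹C¹) − P((C⁰ ∩ B¹) ∪ (B⁰ ∩ C¹)) = P((B¹∖B⁰) ∩ (C¹∖C⁰))` (`SahiFace.face_firstOrder_lower`), from two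
applications of Harris' inequality, monotonicity and inclusion–exclusion.  So `C₃` cannot fail at first order
at any face of this type, for any increasing events.

Context (why this matters for the cell).  For the percolation events `B_v = {s ↔ v}` the same face
("near-sure root–target pair `s–j`, `{s,j}` separating `i` from `k`") is where the independent-copy
comparison `(P_k)` and W-domination FAIL (`IncStar.pk_cex`, `IncStar.not_wdom_forall`, p2 gen 38): their
first-order coefficient is `I_s·B_K − A_I·A_K`, negative as soon as a one-block ratio exceeds the golden
ratio, whereas Sahi's `E₃` carries the extra cushion `q_k·Cov(B_i,B_j)` whose first-order part turns the
coefficient into a sum of nonnegative terms — the percolation instance of the present lemma.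
-/

namespace Summit.CriticalPhenomena.PercolationContinuityZ3.Theorems

namespace SahiFace

open MeasureTheory Set Literature.Probability.LatticeModels

variable {ι : Type*}

/-- **First-order face coefficient of Sahi's `E₃`, lower bound.**  Under a product Bernoulli measure, for
measurable events `A₀, B₀ ⊆ B₁, C₀ ⊆ C₁` with `B₁`, `C₁`, `A₀ ∩ B₀`, `A₀ ∩ C₀` increasing and `B₁, C₁`
independent (`P(B₁ ∩ C₁) = P(B₁)P(C₁)`):
`P(B₁∩C₁) − P((C₀∩B₁) ∪ (B₀∩C₁)) ≤ 2P(A₀∩B₀∩C₀) − P(B₀∩C₀) − P(B₁)P(A₀∩C₀) − P(C₁)P(A₀∩B₀) + P(B₁)P(C₁)`.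
The right side is the `ε`-derivative `Ψ` of `E₃(A,B,C)` at the face "coordinate `x₀` of probability `1−ε`
inside `A`, sections `B⁰ ⊆ B¹ ⊥ C¹ ⊇ C⁰`" (module docstring). [this work] -/
theorem face_firstOrder_lower (p : ι → unitInterval) {A₀ B₀ B₁ C₀ C₁ : Set (Set ι)}
    (hB : B₀ ⊆ B₁) (hC : C₀ ⊆ C₁)
    (hB₁ : IsUpperSet B₁) (hC₁ : IsUpperSet C₁) (hAB : IsUpperSet (A₀ ∩ B₀)) (hAC : IsUpperSet (A₀ ∩ C₀))
    (hA₀m : MeasurableSet A₀) (hB₀m : MeasurableSet B₀) (hB₁m : MeasurableSet B₁)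
    (hC₀m : MeasurableSet C₀) (hC₁m : MeasurableSet C₁)
    (hind : (prodBernoulli p).real (B₁ ∩ C₁) = (prodBernoulli p).real B₁ * (prodBernoulli p).real C₁) :
    (prodBernoulli p).real (B₁ ∩ C₁) - (prodBernoulli p).real ((C₀ ∩ B₁) ∪ (B₀ ∩ C₁))
      ≤ 2 * (prodBernoulli p).real (A₀ ∩ B₀ ∩ C₀) - (prodBernoulli p).real (B₀ ∩ C₀)
        - (prodBernoulli p).real B₁ * (prodBernoulli p).real (A₀ ∩ C₀)
        - (prodBernoulli p).real C₁ * (prodBernoulli p).real (A₀ ∩ B₀)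
        + (prodBernoulli p).real B₁ * (prodBernoulli p).real C₁ := by
  set P := prodBernoulli p with hP
  -- Harris for `B₁` against the up-set `A₀ ∩ C₀`, and for `C₁` against `A₀ ∩ B₀`
  have h1 : P.real B₁ * P.real (A₀ ∩ C₀) ≤ P.real (B₁ ∩ (A₀ ∩ C₀)) :=
    prodBernoulli_harris p hB₁ hAC hB₁m (hA₀m.inter hC₀m)
  have h2 : P.real C₁ * P.real (A₀ ∩ B₀) ≤ P.real (C₁ ∩ (A₀ ∩ B₀)) :=
    prodBernoulli_harris p hC₁ hAB hC₁m (hA₀m.inter hB₀m)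
  -- split `B₁ ∩ (A₀ ∩ C₀)` along `B₀`
  have h3 : P.real (B₁ ∩ (A₀ ∩ C₀)) ≤ P.real (A₀ ∩ B₀ ∩ C₀) + (P.real (C₀ ∩ B₁) - P.real (B₀ ∩ C₀)) := by
    have hs := measureReal_sdiff_add_inter (μ := P) (s := B₁ ∩ (A₀ ∩ C₀)) hB₀m
    have ht := measureReal_sdiff_add_inter (μ := P) (s := C₀ ∩ B₁) hB₀m
    have e1 : B₁ ∩ (A₀ ∩ C₀) ∩ B₀ = A₀ ∩ B₀ ∩ C₀ := by
      ext ω; simp only [Set.mem_inter_iff]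
      constructor
      · rintro ⟨⟨-, h2, h3⟩, h4⟩; exact ⟨⟨h2, h4⟩, h3⟩
      · rintro ⟨⟨h2, h4⟩, h3⟩; exact ⟨⟨hB h4, h2, h3⟩, h4⟩
    have e2 : C₀ ∩ B₁ ∩ B₀ = B₀ ∩ C₀ := by
      ext ω; simp only [Set.mem_inter_iff]
      constructor
      · rintro ⟨⟨h1, -⟩, h3⟩; exact ⟨h3, h1⟩
      · rintro ⟨h3, h1⟩; exact ⟨⟨h1, hB h3⟩, h3⟩
    have hmono : P.real ((B₁ ∩ (A₀ ∩ C₀)) \ B₀) ≤ P.real ((C₀ ∩ B₁) \ B₀) :=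
      measureReal_mono (fun ω hω => ⟨⟨hω.1.2.2, hω.1.1⟩, hω.2⟩)
    rw [e1] at hs; rw [e2] at ht
    linarith
  -- the same for `C₁ ∩ (A₀ ∩ B₀)` along `C₀`
  have h4 : P.real (C₁ ∩ (A₀ ∩ B₀)) ≤ P.real (A₀ ∩ B₀ ∩ C₀) + (P.real (B₀ ∩ C₁) - P.real (B₀ ∩ C₀)) := by
    have hs := measureReal_sdiff_add_inter (μ := P) (s := C₁ ∩ (A₀ ∩ B₀)) hC₀m
    have ht := measureReal_sdiff_add_inter (μ := P) (s := B₀ ∩ C₁) hC₀m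
    have e1 : C₁ ∩ (A₀ ∩ B₀) ∩ C₀ = A₀ ∩ B₀ ∩ C₀ := by
      ext ω; simp only [Set.mem_inter_iff]
      constructor
      · rintro ⟨⟨-, h2, h3⟩, h4⟩; exact ⟨⟨h2, h3⟩, h4⟩
      · rintro ⟨⟨h2, h3⟩, h4⟩; exact ⟨⟨hC h4, h2, h3⟩, h4⟩
    have e2 : B₀ ∩ C₁ ∩ C₀ = B₀ ∩ C₀ := by
      ext ω; simp only [Set.mem_inter_iff]
      constructor
      · rintro ⟨⟨h1, -⟩, h3⟩; exact ⟨h1, h3⟩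
      · rintro ⟨h1, h3⟩; exact ⟨⟨h1, hC h3⟩, h3⟩
    have hmono : P.real ((C₁ ∩ (A₀ ∩ B₀)) \ C₀) ≤ P.real ((B₀ ∩ C₁) \ C₀) :=
      measureReal_mono (fun ω hω => ⟨⟨hω.1.2.2, hω.1.1⟩, hω.2⟩)
    rw [e1] at hs; rw [e2] at ht
    linarith
  -- inclusion–exclusion for `(C₀ ∩ B₁) ∪ (B₀ ∩ C₁)`, whose intersection is `B₀ ∩ C₀`
  have h5 : P.real ((C₀ ∩ B₁) ∪ (B₀ ∩ C₁)) + P.real (B₀ ∩ C₀) = P.real (C₀ ∩ B₁) + P.real (B₀ ∩ C₁) := by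
    have hu := measureReal_union_add_inter (μ := P) (s := C₀ ∩ B₁) (t := B₀ ∩ C₁) (hB₀m.inter hC₁m)
    have e : C₀ ∩ B₁ ∩ (B₀ ∩ C₁) = B₀ ∩ C₀ := by
      ext ω; simp only [Set.mem_inter_iff]
      constructor
      · rintro ⟨⟨h1, -⟩, h3, -⟩; exact ⟨h3, h1⟩
      · rintro ⟨h3, h1⟩; exact ⟨⟨h1, hB h3⟩, h3, hC h1⟩
    rw [e] at hu; exact hu
  rw [← hind]
  linarith

/-- **Sahi's `C₃` holds to first order at the face "one coordinate near-surely in `A`, the two other sections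
independent".**  Under a product Bernoulli measure, for measurable events `A₀, B₀ ⊆ B₁, C₀ ⊆ C₁` with
`B₁`, `C₁`, `A₀ ∩ B₀`, `A₀ ∩ C₀` increasing and `P(B₁ ∩ C₁) = P(B₁)P(C₁)`:
`0 ≤ 2P(A₀∩B₀∩C₀) − P(B₀∩C₀) − P(B₁)P(A₀∩C₀) − P(C₁)P(A₀∩B₀) + P(B₁)P(C₁)`
(= the `ε`-derivative of `E₃` at the face; a negative value would have refuted `C₃`). [this work] -/
theorem face_firstOrder_nonneg (p : ι → unitInterval) {A₀ B₀ B₁ C₀ C₁ : Set (Set ι)}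
    (hB : B₀ ⊆ B₁) (hC : C₀ ⊆ C₁)
    (hB₁ : IsUpperSet B₁) (hC₁ : IsUpperSet C₁) (hAB : IsUpperSet (A₀ ∩ B₀)) (hAC : IsUpperSet (A₀ ∩ C₀))
    (hA₀m : MeasurableSet A₀) (hB₀m : MeasurableSet B₀) (hB₁m : MeasurableSet B₁)
    (hC₀m : MeasurableSet C₀) (hC₁m : MeasurableSet C₁)
    (hind : (prodBernoulli p).real (B₁ ∩ C₁) = (prodBernoulli p).real B₁ * (prodBernoulli p).real C₁) :
    0 ≤ 2 * (prodBernoulli p).real (A₀ ∩ B₀ ∩ C₀) - (prodBernoulli p).real (B₀ ∩ C₀)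
        - (prodBernoulli p).real B₁ * (prodBernoulli p).real (A₀ ∩ C₀)
        - (prodBernoulli p).real C₁ * (prodBernoulli p).real (A₀ ∩ B₀)
        + (prodBernoulli p).real B₁ * (prodBernoulli p).real C₁ := by
  have h := face_firstOrder_lower p hB hC hB₁ hC₁ hAB hAC hA₀m hB₀m hB₁m hC₀m hC₁m hind
  have hmono : (prodBernoulli p).real ((C₀ ∩ B₁) ∪ (B₀ ∩ C₁)) ≤ (prodBernoulli p).real (B₁ ∩ C₁) :=
    measureReal_mono (by
      rintro ω (⟨h1, h2⟩ | ⟨h1, h2⟩)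
      · exact ⟨h2, hC h1⟩
      · exact ⟨hB h1, h2⟩)
  linarith

/-- **The face value of `E₃` itself.**  With `A = Ω` and `B, C` independent, Sahi's functional vanishes:
`sahiE3 P univ B C = P(B∩C) − P(B)P(C) = 0` — the degenerate face at which the first-order analysis above
takes place. [this work] -/
theorem sahiE3_univ_eq_cov {Ω : Type*} [MeasurableSpace Ω] (μ : Measure Ω) [IsProbabilityMeasure μ]
    (B C : Set Ω) :
    sahiE3 μ Set.univ B C = μ.real (B ∩ C) - μ.real B * μ.real C := by
  rw [sahiE3_def]
  simp only [Set.univ_inter, probReal_univ]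
  ring

end SahiFace

end Summit.CriticalPhenomena.PercolationContinuityZ3.Theorems
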